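import Summits.MatrixMultiplication.OmegaCensus.DominoZpZpCells
import Summits.MatrixMultiplication.OmegaCensus.DominoZpZpStructFour
import Summits.MatrixMultiplication.OmegaCensus.DominoZ31StructFourTableA
import Summits.MatrixMultiplication.OmegaCensus.DominoZ31StructFourTableB
import Summits.MatrixMultiplication.OmegaCensus.DominoZ31StructFourTableC
import Summits.MatrixMultiplication.OmegaCensus.DominoZ31StructFourTableD
import Summits.MatrixMultiplication.OmegaCensus.DominoZ31StructFourTableE
import HarnessLib

/-!
# No domino cube law with a part of size `4` over any `A ↠ ℤ_31 × ℤ_31` (structural route)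

ω-census `pub-omega`, family (b3), seat pub-omega-group gen 22.  Framing: lottery ticket; floor = certified bounds/negative
ranges.  VALUE: kernel theorems of the `ℤ_p²`-quotient column (`p = 31`) of the Dih-side mod-one classification — the census
cell `(1,4,80)@961` and every larger order, any `c₀` — by the STRUCTURAL part-`4` route `DominoZpZpStructFour.lean` (no kernel
enumeration of value functions): the certified table `tableZ31s4` of the 512 normalised repeated count vectors, its key tree,
the `checkFour` completeness decide, `exists_entry_structFour`, and the generic cell theorems of `DominoZpZpCells.lean`
(half `η = 16`: `16 + 16 = 1` in `ZMod 31`); NOT progress on ω.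

* `exists_table_entry_31_4s` — the scaled cover hypothesis for `d = 4`;
* `no_law_cube_14e_of_onto_z31z31` / `no_law_cube_1d4_of_onto_z31z31` — the cells.
-/

namespace Summit.MatrixMultiplication.OmegaCensus

open Finset ZpZpDomino Literature.Combinatorics.Additive

namespace ZpZpDomino

/-- The certified table of the structural part-`4` route for `p = 31` (5 file(s), 512 entries, increasing codes). [folklore] -/
noncomputable def tableZ31s4 : List (List ℕ × List (ℕ × List ℕ)) := tableZ31s4a ++ tableZ31s4b ++ tableZ31s4c ++ tableZ31s4d ++ tableZ31s4e

/-- Every entry of `tableZ31s4` is a valid certificate. [folklore] -/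
theorem tableZ31s4_cert : ∀ e ∈ tableZ31s4, lineCert 31 (vecFn e.1) e.2 = true := by
  intro e he
  simp only [tableZ31s4, List.mem_append] at he
  rcases he with (((h0 | h1) | h2) | h3) | h4
  · exact tableZ31s4a_cert e h0
  · exact tableZ31s4b_cert e h1
  · exact tableZ31s4c_cert e h2
  · exact tableZ31s4d_cert e h3
  · exact tableZ31s4e_cert e h4

/-- Key tree of `tableZ31s4` (codes `polyBE 5`, balanced build). [folklore] -/
noncomputable def tabTreeZ31s4 : BTree := tabTree 5 512 tableZ31s4

set_option maxHeartbeats 4000000 in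
/-- The keys are well formed (length `31`, digits `< 5`). [folklore] -/
theorem tableZ31s4_wf : tabWF 31 5 tableZ31s4 = true := by decide +kernel

set_option maxHeartbeats 4000000 in
/-- **Completeness**: the key tree contains the count vector of every normalised repeated quadruple (`31² + 31 + 2` lookups).
[folklore] -/
theorem checkFour_31 : checkFour 31 tabTreeZ31s4 = true := by decide +kernel

/-- **Every value function of sum `4` on `ZMod 31 × ZMod 31` (as `961` values) has a line direction whose count vector is,
up to a unit scaling of `ZMod 31`, a certified entry of `tableZ31s4`** (structural route; the normal-form clause is unused).
[folklore] -/
theorem exists_table_entry_31_4s (g : Fin (31 * 31) → ℕ) (hg : ∑ i, g i = 4)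
    (_hNF : (1 ≤ g ⟨31, by decide⟩ ∧ 1 ≤ g ⟨1, by decide⟩) ∨
      (1 ≤ g ⟨31, by decide⟩ ∧ ∀ i : Fin (31 * 31), i.val % 31 ≠ 0 → g i = 0) ∨ (∀ i : Fin (31 * 31), i.val ≠ 0 → g i = 0)) :
    ∃ j < 31 + 1, ∃ k : ℕ, k % 31 ≠ 0 ∧ ∃ e ∈ tableZ31s4, ∀ v < 31,
      e.1.getD (k * v % 31) 0 = ∑ i : Fin (31 * 31), pick v (pv 31 j i.val) (g i) :=
  haveI : Fact (Nat.Prime 31) := ⟨by decide⟩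
  exists_entry_structFour (by decide) tableZ31s4 tabTreeZ31s4 (fun _ h => mem_tabTree h) tableZ31s4_wf checkFour_31 g hg

end ZpZpDomino

/-- `16` is a half in `ZMod 31`. [folklore] -/
theorem structFour_half_zmod31 : (16 : ZMod 31) + 16 = 1 := by decide

variable {A : Type} [AddCommGroup A] [DecidableEq A] [Fintype A] {G : Type} [Group G] [DecidableEq G]
  {ρ τ : A → G} {c₀ : A} {S T U : Finset G}

/-- **No `(1,1 | 4,4 | e,e)` law triple over `A ↠ ℤ_31 × ℤ_31`**: dihedral-like `G` over `A` (any `c₀`), `φ` onto, TPP triple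
with coset parts `|S₀| = |S₁| = 1`, `|T₀| = |T₁| = 4`, `|U₀| = |U₁|` ⇒ `3|S||T||U| + 8 ≠ 8|A|` — census cell `(1,4,80)@961`
and all larger orders. [folklore] -/
theorem no_law_cube_14e_of_onto_z31z31
    (hρρ : ∀ a b, ρ a * ρ b = ρ (a + b)) (hρτ : ∀ a b, ρ a * τ b = τ (b - a))
    (hτρ : ∀ a b, τ a * ρ b = τ (a + b)) (hττ : ∀ a b, τ a * τ b = ρ (c₀ + b - a))
    (hρ : Function.Injective ρ) (hτ : Function.Injective τ) (hne : ∀ a b, ρ a ≠ τ b)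
    (hsurj : ∀ g, (∃ a, ρ a = g) ∨ (∃ a, τ a = g))
    (φ : A →+ ZMod 31 × ZMod 31) (hφ : Function.Surjective φ)
    (h : TripleProductProperty S T U)
    (hS₀ : (univ.filter fun a : A => ρ a ∈ S).card = 1) (hS₁ : (univ.filter fun a : A => τ a ∈ S).card = 1)
    (hT₀ : (univ.filter fun a : A => ρ a ∈ T).card = 4) (hT₁ : (univ.filter fun a : A => τ a ∈ T).card = 4)
    (hU : (univ.filter fun a : A => ρ a ∈ U).card = (univ.filter fun a : A => τ a ∈ U).card)
    (hV : 3 * (S.card * T.card * U.card) + 8 = 8 * Fintype.card A) : False :=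
  haveI : Fact (Nat.Prime 31) := ⟨by decide⟩
  no_law_cube_1de_of_onto_zpzp_of_cover (16 : ZMod 31) structFour_half_zmod31 tableZ31s4 tableZ31s4_cert ⟨31, by decide⟩ ⟨1, by decide⟩
    rfl rfl exists_table_entry_31_4s hρρ hρτ hτρ hττ hρ hτ hne hsurj φ hφ h hS₀ hS₁ hT₀ hT₁ hU hV

/-- **No `(1,1 | d,d | 4,4)` law triple over `A ↠ ℤ_31 × ℤ_31`** (the part `4` in `U`). [folklore] -/
theorem no_law_cube_1d4_of_onto_z31z31
    (hρρ : ∀ a b, ρ a * ρ b = ρ (a + b)) (hρτ : ∀ a b, ρ a * τ b = τ (b - a))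
    (hτρ : ∀ a b, τ a * ρ b = τ (a + b)) (hττ : ∀ a b, τ a * τ b = ρ (c₀ + b - a))
    (hρ : Function.Injective ρ) (hτ : Function.Injective τ) (hne : ∀ a b, ρ a ≠ τ b)
    (hsurj : ∀ g, (∃ a, ρ a = g) ∨ (∃ a, τ a = g))
    (φ : A →+ ZMod 31 × ZMod 31) (hφ : Function.Surjective φ)
    (h : TripleProductProperty S T U)
    (hS₀ : (univ.filter fun a : A => ρ a ∈ S).card = 1) (hS₁ : (univ.filter fun a : A => τ a ∈ S).card = 1)
    (hT : (univ.filter fun a : A => ρ a ∈ T).card = (univ.filter fun a : A => τ a ∈ T).card)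
    (hU₀ : (univ.filter fun a : A => ρ a ∈ U).card = 4) (hU₁ : (univ.filter fun a : A => τ a ∈ U).card = 4)
    (hV : 3 * (S.card * T.card * U.card) + 8 = 8 * Fintype.card A) : False :=
  haveI : Fact (Nat.Prime 31) := ⟨by decide⟩
  no_law_cube_1d_e_of_onto_zpzp_of_cover (16 : ZMod 31) structFour_half_zmod31 tableZ31s4 tableZ31s4_cert ⟨31, by decide⟩ ⟨1, by decide⟩
    rfl rfl exists_table_entry_31_4s hρρ hρτ hτρ hττ hρ hτ hne hsurj φ hφ h hS₀ hS₁ hT hU₀ hU₁ hV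

end Summit.MatrixMultiplication.OmegaCensus
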